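import Literature.AlgebraicGeometry.Motives.AlgPointsAlterationOntoImage
import Literature.AlgebraicGeometry.Motives.JacobianBrillNoetherLocusDimensionLe
import HarnessLib

/-!
# The Abel sum map onto `W̃_r(P)` is an alteration — RELATIVE-UNIQUENESS edition (any `n = r + s`, any algebraically closed field)

Layer `Literature/AlgebraicGeometry/Motives` (namespace `….Motives.Jacobian`).  KERNEL ONLY (theorems; no definition, no named fact, no instance,
no `sorry`).

★ `Motives/JacobianBrillNoetherLocusDimensionLe` §1 (`Jacobian.exists_isAlteration_lift_abelSum_of_add`) asks for `n`-fold uniqueness of Abel sums on a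
non-empty open `U₁ ⊆ J` EVERY point of which is an `n`-fold Abel sum — which forces `W̃_n(P) ⊇ U₁` to be dense, i.e. `n ≥ dim J` (and then `n = dim J`
by uniqueness), so that over a general algebraically closed field the lemma has no instance below the top.  Milne (*Jacobian Varieties* §5, Thm. 5.1 (a))
and Lange (§4.2.1 Lemma 4.2.1 (ii)) prove the RELATIVE statement: for every `n ≤ g` the map `f^{(n)} : C^{(n)} → W^n` is birational, i.e. `n`-fold Abel
sums are unique up to order over a non-empty open OF `W̃_n(P)`.  This file records the alteration argument in that relative shape, over the
generic «alteration onto a closed irreducible `Z ⊇ image`» packaging ★ `Motives/AlgPointsAlterationOntoImage`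
(`AlgPoints.exists_isAlteration_lift_of_finite_nonempty_fibres`, `AlgPoints.topologicalKrullDim_coe_eq_of_finite_nonempty_fibres`):

* §1 **`Jacobian.exists_isAlteration_lift_abelSum_of_uniqueOn`** — granted a non-empty open `U₁ ⊆ J` MEETING `W̃_n(P)` over which `n`-fold Abel sums are
  unique up to a permutation (`n = r + s`), the Abel sum map `α_r : C^r → J` lifts through the reduced closed subscheme on `W̃_r(P)` to an ALTERATION;
  hence **`Jacobian.topologicalKrullDim_brillNoetherLocus_of_uniqueOn`**: `dim W̃_r(P) = r` for every `r ≤ n`.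
* §2 the §1 shape of ★ `…DimensionLe` is the special case `U₁ ⊆ W̃_n(P)`: **`uniqueOn_of_hopen`** (so this edition subsumes that one), and the complex
  instance **`exists_opens_uniqueOn_abelSum_of_isSmoothProjective`** at `n = dim J` (★ (γ) `exists_opens_general_abelSum_of_isSmoothProjective`).

Use (cell `hodgecm-mathlib`, D-0151; crux HLiu418 = stmt-HodgeConjecture-24832; Brill–Noether ∕ theta-divisor capital next to rows VI-7∕VI-8).  COUNT-NEUTRAL.
HC_CM is proved only modulo the 7 printed citations until rung 0 closes; this file moves no book by itself.

## References
* [Milne1986JacobianVarieties] J. S. Milne, *Jacobian Varieties*, in Cornell–Silverman (1986), §5 (the maps `f^r : C^r → J`), Thm. 5.1 (a).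
* [Lange2023AbelianVarietiesComplex] H. Lange, *Abelian Varieties over the Complex Numbers* (2023), §4.2.1 Lemma 4.2.1 (ii).
* [DeJong1996] A. J. de Jong, *Smoothness, semi-stability and alterations*, Publ. Math. IHÉS 83 (1996), 2.20, p. 61.
-/

set_option autoImplicit false

noncomputable section

universe u

open CategoryTheory AlgebraicGeometry Order TopologicalSpace Opposite

namespace Literature.AlgebraicGeometry.Motives

namespace Jacobian

open RelativeSpec Literature.AlgebraicGeometry.Resolution Literature.AlgebraicGeometry.Dimension Scheme.IdealSheafData

/-! ## §1 The alteration `C^r → W̃_r(P)` from uniqueness of `(r+s)`-fold Abel sums over an open meeting `W̃_{r+s}(P)` -/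

section AnyField

variable {k : Type u} [Field k] [IsAlgClosed k] {C : SchemeOver k} [SmoothOfRelativeDimension 1 C.hom] [IsProper C.hom]
  [GeometricallyIntegral C.hom] (𝒥 : Jacobian C) (P : AlgPoints C k) (r s : ℕ) {n : ℕ} (hn : r + s = n)

omit [SmoothOfRelativeDimension 1 C.hom] [GeometricallyIntegral C.hom] in
include hn in
/-- **The three fibre facts of the Abel sum map `α_r : C^r → J` over the open `V = ⋃_ρ t_{α_s(ρ)}⁻¹ U₁`**, granted uniqueness of `n`-fold Abel sums
up to order over an open `U₁` meeting `W̃_n(P)`, `n = r + s`: (i) `V` meets `W̃_r(P)` (split an `n`-fold Abel sum lying in `U₁` as `α_r(τ|_r) · α_s(τ|^s)`);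
(ii) over `k`-points `a ∈ V ∩ W̃_r(P)` the `k`-point fibre of `α_r` is FINITE (`a = α_r(τ₁)`, `a · α_s(ρ) = α_n(τ₁ ⧺ ρ) ∈ U₁`; every `z` over `a`
gives the `n`-tuple `(coords z) ⧺ ρ` with the same Abel sum, a permutation of `τ₁ ⧺ ρ`, and `z` is recovered from its coordinates); (iii) over every
`k`-point of `W̃_r(P)` the fibre is NON-EMPTY (★ `pt_mem_brillNoetherLocus_iff`).  Milne §5: the fibres of `f^{(r)}` over `W^r`.
[cite: Milne1986JacobianVarieties, §5 (the maps f^r : C^r → J) and Thm. 5.1 (a)] [cite: Lange2023AbelianVarietiesComplex, §4.2.1 Lemma 4.2.1 (ii)] -/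
theorem abelSum_fibres_of_uniqueOn
    (huniq : ∃ U₁ : 𝒥.J.X.left.Opens, ((U₁ : Set 𝒥.J.X.left) ∩ 𝒥.brillNoetherLocus P n).Nonempty ∧
      ∀ τ τ' : Fin n → AlgPoints C k, ((∏ j : Fin n, τ j ≫ 𝒥.abelJacobi P : 𝒥.J.Points k)).pt ∈ U₁ →
        (∏ j : Fin n, τ' j ≫ 𝒥.abelJacobi P) = (∏ j : Fin n, τ j ≫ 𝒥.abelJacobi P) →
          ∃ σ : Equiv.Perm (Fin n), τ' = τ ∘ σ) :
    ∃ V : 𝒥.J.X.left.Opens, ((V : Set 𝒥.J.X.left) ∩ 𝒥.brillNoetherLocus P r).Nonempty ∧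
      (∀ a : 𝒥.J.Points k, a.pt ∈ V → a.pt ∈ 𝒥.brillNoetherLocus P r →
        {z : AlgPoints (powOverObj C.hom r) k | AlgPoints.map (𝒥.abelSum P r) z = a}.Finite) ∧
      (∀ a : 𝒥.J.Points k, a.pt ∈ V → a.pt ∈ 𝒥.brillNoetherLocus P r →
        {z : AlgPoints (powOverObj C.hom r) k | AlgPoints.map (𝒥.abelSum P r) z = a}.Nonempty) := by
  classical
  subst hn
  haveI : LocallyOfFiniteType 𝒥.J.X.hom := 𝒥.J.isProper.toLocallyOfFiniteType
  obtain ⟨U₁, hU₁, huniq⟩ := huniq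
  -- the open `V`: points `x` with `x · α_s(ρ) ∈ U₁` for some `s`-tuple `ρ`
  let V : 𝒥.J.X.left.Opens :=
    ⨆ ρ : Fin s → AlgPoints C k, (𝒥.J.translation (∏ j : Fin s, ρ j ≫ 𝒥.abelJacobi P)).left ⁻¹ᵁ U₁
  have hmemV : ∀ x : 𝒥.J.Points k, x.pt ∈ V ↔
      ∃ ρ : Fin s → AlgPoints C k, (x * ∏ j : Fin s, ρ j ≫ 𝒥.abelJacobi P).pt ∈ U₁ := by
    intro x
    simp only [V, Opens.mem_iSup]
    refine exists_congr fun ρ => ?_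
    have hmap : AlgPoints.map (𝒥.J.translation (∏ j : Fin s, ρ j ≫ 𝒥.abelJacobi P)) x =
        x * ∏ j : Fin s, ρ j ≫ 𝒥.abelJacobi P :=
      (𝒥.J.comp_translation x _).trans (mul_comm _ _)
    change (𝒥.J.translation (∏ j : Fin s, ρ j ≫ 𝒥.abelJacobi P)).left.base x.pt ∈ U₁ ↔ _
    rw [← AlgPoints.pt_map, hmap]
  -- splitting an `(r+s)`-tuple into its first `r` and last `s` coordinates splits its Abel sum
  have hsplit : ∀ τ : Fin (r + s) → AlgPoints C k,
      (∏ j : Fin r, τ (Fin.castAdd s j) ≫ 𝒥.abelJacobi P) * (∏ j : Fin s, τ (Fin.natAdd r j) ≫ 𝒥.abelJacobi P) =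
        ∏ j : Fin (r + s), τ j ≫ 𝒥.abelJacobi P :=
    fun τ => (Fin.prod_univ_add (fun j => τ j ≫ 𝒥.abelJacobi P)).symm
  refine ⟨V, ?_, ?_, ?_⟩
  · -- (i) `V` meets `W̃_r(P)`: a closed point of `U₁ ∩ W̃_{r+s}(P)` is `w · α_s(ρ)` with `w ∈ W̃_r(P)`
    haveI : JacobsonSpace 𝒥.J.X.left := LocallyOfFiniteType.jacobsonSpace 𝒥.J.X.hom
    obtain ⟨x₁, ⟨hx₁U, hx₁W⟩, hx₁cl⟩ := nonempty_inter_closedPoints hU₁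
      (U₁.2.isLocallyClosed.inter (𝒥.isClosed_brillNoetherLocus P (r + s)).isLocallyClosed)
    obtain ⟨a₁, ha₁⟩ := AlgPoints.exists_pt_eq_of_isClosed_singleton (X := 𝒥.J.X) (mem_closedPoints_iff.mp hx₁cl)
    obtain ⟨τ, hτ⟩ := (𝒥.pt_mem_brillNoetherLocus_iff P (r + s) a₁).mp (ha₁ ▸ hx₁W)
    set w : 𝒥.J.Points k := ∏ j : Fin r, τ (Fin.castAdd s j) ≫ 𝒥.abelJacobi P with hw
    refine ⟨w.pt, (hmemV w).mpr ⟨fun j => τ (Fin.natAdd r j), ?_⟩, (𝒥.pt_mem_brillNoetherLocus_iff P r w).mpr ⟨_, rfl⟩⟩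
    rw [hw, hsplit τ, hτ, ha₁]
    exact hx₁U
  · -- (ii) finiteness of the `k`-point fibres over `V ∩ W̃_r(P)`
    intro x hxV hxW
    obtain ⟨ρ, hρ⟩ := (hmemV x).mp hxV
    obtain ⟨τ₁, hτ₁⟩ := (𝒥.pt_mem_brillNoetherLocus_iff P r x).mp hxW
    set τ₀ : Fin (r + s) → AlgPoints C k := Fin.append τ₁ ρ with hτ₀def
    have hτ₀ : (∏ j : Fin (r + s), τ₀ j ≫ 𝒥.abelJacobi P) = x * ∏ j : Fin s, ρ j ≫ 𝒥.abelJacobi P := by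
      rw [← hsplit τ₀]
      simp only [hτ₀def, Fin.append_left, Fin.append_right, hτ₁]
    have hτ₀U : ((∏ j : Fin (r + s), τ₀ j ≫ 𝒥.abelJacobi P : 𝒥.J.Points k)).pt ∈ U₁ := hτ₀ ▸ hρ
    -- each `z` over `x` gives an `(r+s)`-tuple with Abel sum `x · α_s(ρ)`, hence a permutation of `τ₀`
    have key : ∀ z : {z : AlgPoints (powOverObj C.hom r) k | AlgPoints.map (𝒥.abelSum P r) z = x},
        ∃ σ : Equiv.Perm (Fin (r + s)),
          (Fin.append (fun j : Fin r => (z : AlgPoints (powOverObj C.hom r) k) ≫ (projOver C.hom r j : powOverObj C.hom r ⟶ C)) ρ :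
            Fin (r + s) → AlgPoints C k) = τ₀ ∘ σ := by
      rintro ⟨z, hz⟩
      apply huniq τ₀ _ hτ₀U
      have hz' : z ≫ 𝒥.abelSum P r = x := hz
      rw [comp_abelSum_eq_prod] at hz'
      rw [hτ₀, ← hsplit]
      simp only [Fin.append_left, Fin.append_right]
      exact congrArg (· * ∏ j : Fin s, ρ j ≫ 𝒥.abelJacobi P) hz'
    choose σ hσ using key
    have hinj : Function.Injective σ := by
      rintro ⟨z, hz⟩ ⟨z', hz'⟩ h
      have h1 := hσ ⟨z, hz⟩
      have h2 := hσ ⟨z', hz'⟩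
      rw [h, ← h2] at h1
      apply Subtype.ext
      refine hom_ext_projOver C.hom r z z' fun j => ?_
      have := congrFun h1 (Fin.castAdd s j)
      simp only [Fin.append_left] at this
      exact this
    exact Set.finite_coe_iff.mp (Finite.of_injective σ hinj)
  · -- (iii) non-emptiness of the `k`-point fibres over `W̃_r(P)`
    intro x _ hxW
    obtain ⟨τ, hτ⟩ := (𝒥.pt_mem_brillNoetherLocus_iff P r x).mp hxW
    refine ⟨liftOver C.hom r τ, ?_⟩
    change liftOver C.hom r τ ≫ 𝒥.abelSum P r = x
    rw [liftOver_comp_abelSum, hτ]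

include hn in
/-- **The Abel sum map `α_r` lifts to an ALTERATION onto `W̃_r(P)` (reduced structure), granted uniqueness of `n`-fold Abel sums up to order over a
non-empty open of `J` MEETING `W̃_n(P)`, `n = r + s`** (Milne §5 Thm. 5.1 (a): `f^{(n)} : C^{(n)} → W^n` is birational for `n ≤ g`; here only
«generically injective up to `𝔖_n`» is used): the `k`-point fibre of `α_r` over `w ∈ W̃_r(P)` injects, by `z ↦ (coords z) ⧺ ρ`, into the set of
`n`-tuples with Abel sum `w · α_s(ρ)`, a single `𝔖_n`-orbit whenever `w · α_s(ρ) ∈ U₁`; and `w · α_s(ρ) ∈ U₁` holds for `w` in a non-empty open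
of `W̃_r(P)` because some `n`-fold Abel sum lies in `U₁` — the three fibre facts above, fed to ★ `AlgPoints.exists_isAlteration_lift_of_finite_nonempty_fibres`.
[cite: Milne1986JacobianVarieties, §5 (the maps f^r : C^r → J) and Thm. 5.1 (a)] [cite: Lange2023AbelianVarietiesComplex, §4.2.1 Lemma 4.2.1 (ii)]
[cite: DeJong1996, 2.20, p. 61] -/
theorem exists_isAlteration_lift_abelSum_of_uniqueOn
    (huniq : ∃ U₁ : 𝒥.J.X.left.Opens, ((U₁ : Set 𝒥.J.X.left) ∩ 𝒥.brillNoetherLocus P n).Nonempty ∧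
      ∀ τ τ' : Fin n → AlgPoints C k, ((∏ j : Fin n, τ j ≫ 𝒥.abelJacobi P : 𝒥.J.Points k)).pt ∈ U₁ →
        (∏ j : Fin n, τ' j ≫ 𝒥.abelJacobi P) = (∏ j : Fin n, τ j ≫ 𝒥.abelJacobi P) →
          ∃ σ : Equiv.Perm (Fin n), τ' = τ ∘ σ) :
    ∃ φ : (powOverObj C.hom r).left ⟶
        (vanishingIdeal (⟨𝒥.brillNoetherLocus P r, 𝒥.isClosed_brillNoetherLocus P r⟩ : Closeds 𝒥.J.X.left)).subscheme,
      φ ≫ (vanishingIdeal (⟨𝒥.brillNoetherLocus P r, 𝒥.isClosed_brillNoetherLocus P r⟩ : Closeds 𝒥.J.X.left)).subschemeι =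
        (𝒥.abelSum P r).left ∧ IsAlteration φ := by
  classical
  subst hn
  obtain ⟨V, hV, hfin, hne⟩ := 𝒥.abelSum_fibres_of_uniqueOn P r s rfl huniq
  haveI : IsIntegral (powOverObj C.hom r).left := (CurvePlaces.isIntegral_powOver_hom C r).1
  haveI : LocallyOfFiniteType 𝒥.J.X.hom := 𝒥.J.isProper.toLocallyOfFiniteType
  haveI : LocallyOfFiniteType (powOverObj C.hom r).hom := locallyOfFiniteType_powOver_base C.hom r
  haveI : IsProper ((𝒥.abelSum P r).left ≫ 𝒥.J.X.hom) := by
    rw [Over.w (𝒥.abelSum P r)]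
    exact isProper_powOver_base C.hom r
  haveI : IsProper (𝒥.abelSum P r).left := IsProper.of_comp (𝒥.abelSum P r).left 𝒥.J.X.hom
  exact AlgPoints.exists_isAlteration_lift_of_finite_nonempty_fibres (𝒥.abelSum P r)
    ⟨𝒥.brillNoetherLocus P r, 𝒥.isClosed_brillNoetherLocus P r⟩ (𝒥.isIrreducible_brillNoetherLocus P r)
    (𝒥.range_abelSum_subset_brillNoetherLocus P r) V hV hfin hne

include hn in
/-- **`dim W̃_r(P) = r`, granted uniqueness of `n`-fold Abel sums up to order over a non-empty open of `J` meeting `W̃_n(P)`, `n = r + s`**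
(Lange Lemma 4.2.1 (ii), Milne §5 Thm. 5.1 (a), for every `r ≤ n`): `C^r → W̃_r(P)` is an alteration (above), alterations preserve dimension
(★ `AlgPoints.topologicalKrullDim_coe_eq_of_finite_nonempty_fibres`, de Jong 2.20) and `dim C^r = r`.
[cite: Lange2023AbelianVarietiesComplex, §4.2.1 Lemma 4.2.1 (ii)] [cite: Milne1986JacobianVarieties, §5 (the maps f^r : C^r → J) and Thm. 5.1 (a)]
[cite: DeJong1996, 2.20, p. 61] -/
theorem topologicalKrullDim_brillNoetherLocus_of_uniqueOn
    (huniq : ∃ U₁ : 𝒥.J.X.left.Opens, ((U₁ : Set 𝒥.J.X.left) ∩ 𝒥.brillNoetherLocus P n).Nonempty ∧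
      ∀ τ τ' : Fin n → AlgPoints C k, ((∏ j : Fin n, τ j ≫ 𝒥.abelJacobi P : 𝒥.J.Points k)).pt ∈ U₁ →
        (∏ j : Fin n, τ' j ≫ 𝒥.abelJacobi P) = (∏ j : Fin n, τ j ≫ 𝒥.abelJacobi P) →
          ∃ σ : Equiv.Perm (Fin n), τ' = τ ∘ σ) :
    topologicalKrullDim ↥(𝒥.brillNoetherLocus P r) = (r : WithBot ℕ∞) := by
  obtain ⟨V, hV, hfin, hne⟩ := 𝒥.abelSum_fibres_of_uniqueOn P r s hn huniq
  haveI : IsIntegral (powOverObj C.hom r).left := (CurvePlaces.isIntegral_powOver_hom C r).1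
  haveI : LocallyOfFiniteType 𝒥.J.X.hom := 𝒥.J.isProper.toLocallyOfFiniteType
  haveI : LocallyOfFiniteType (powOverObj C.hom r).hom := locallyOfFiniteType_powOver_base C.hom r
  haveI : IsProper ((𝒥.abelSum P r).left ≫ 𝒥.J.X.hom) := by
    rw [Over.w (𝒥.abelSum P r)]
    exact isProper_powOver_base C.hom r
  haveI : IsProper (𝒥.abelSum P r).left := IsProper.of_comp (𝒥.abelSum P r).left 𝒥.J.X.hom
  haveI : SmoothOfRelativeDimension r (powOverObj C.hom r).hom := by
    have h := smoothOfRelativeDimension_powOver_base C.hom 1 r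
    rw [Nat.mul_one] at h
    exact h
  have h := AlgPoints.topologicalKrullDim_coe_eq_of_finite_nonempty_fibres (𝒥.abelSum P r)
    ⟨𝒥.brillNoetherLocus P r, 𝒥.isClosed_brillNoetherLocus P r⟩ (𝒥.isIrreducible_brillNoetherLocus P r)
    (𝒥.range_abelSum_subset_brillNoetherLocus P r) V hV hfin hne
  rw [topologicalKrullDim_eq_of_smoothOfRelativeDimension (powOverObj C.hom r).hom r] at h
  exact h

/-! ## §2 The §1 shape of ★ `…DimensionLe` is the special case `U₁ ⊆ W̃_n(P)` -/

omit [SmoothOfRelativeDimension 1 C.hom] [GeometricallyIntegral C.hom] in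
/-- **The `hopen` hypothesis of ★ `exists_isAlteration_lift_abelSum_of_add` implies the relative-uniqueness hypothesis of §1** (with the same open
`U₁`, which then consists of `n`-fold Abel sums, so `U₁ ∩ W̃_n(P) ⊇ U₁ ∩ {closed points} ≠ ∅`): this edition subsumes that one.
[cite: Milne1986JacobianVarieties, §5 Thm. 5.1 (a)] -/
theorem uniqueOn_of_hopen
    (hopen : ∃ U₁ : 𝒥.J.X.left.Opens, (U₁ : Set 𝒥.J.X.left).Nonempty ∧
      ∀ a : 𝒥.J.Points k, a.pt ∈ U₁ → ∃ τ : Fin n → AlgPoints C k,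
        (∏ j : Fin n, τ j ≫ 𝒥.abelJacobi P) = a ∧
        ∀ τ' : Fin n → AlgPoints C k, (∏ j : Fin n, τ' j ≫ 𝒥.abelJacobi P) = a →
          ∃ σ : Equiv.Perm (Fin n), τ' = τ ∘ σ) :
    ∃ U₁ : 𝒥.J.X.left.Opens, ((U₁ : Set 𝒥.J.X.left) ∩ 𝒥.brillNoetherLocus P n).Nonempty ∧
      ∀ τ τ' : Fin n → AlgPoints C k, ((∏ j : Fin n, τ j ≫ 𝒥.abelJacobi P : 𝒥.J.Points k)).pt ∈ U₁ →
        (∏ j : Fin n, τ' j ≫ 𝒥.abelJacobi P) = (∏ j : Fin n, τ j ≫ 𝒥.abelJacobi P) →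
          ∃ σ : Equiv.Perm (Fin n), τ' = τ ∘ σ := by
  classical
  haveI : LocallyOfFiniteType 𝒥.J.X.hom := 𝒥.J.isProper.toLocallyOfFiniteType
  haveI : JacobsonSpace 𝒥.J.X.left := LocallyOfFiniteType.jacobsonSpace 𝒥.J.X.hom
  obtain ⟨U₁, hU₁, h⟩ := hopen
  refine ⟨U₁, ?_, fun τ τ' hτU hττ' => ?_⟩
  · obtain ⟨x₁, hx₁U, hx₁cl⟩ := nonempty_inter_closedPoints hU₁ U₁.2.isLocallyClosed
    obtain ⟨a₁, ha₁⟩ := AlgPoints.exists_pt_eq_of_isClosed_singleton (X := 𝒥.J.X) (mem_closedPoints_iff.mp hx₁cl)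
    obtain ⟨τ, hτ, -⟩ := h a₁ (ha₁ ▸ hx₁U)
    exact ⟨x₁, hx₁U, ha₁ ▸ (𝒥.pt_mem_brillNoetherLocus_iff P n a₁).mpr ⟨τ, hτ⟩⟩
  · obtain ⟨τ₀, -, hu⟩ := h _ hτU
    obtain ⟨σ, hσ⟩ := hu τ rfl
    obtain ⟨σ', hσ'⟩ := hu τ' hττ'
    refine ⟨σ⁻¹ * σ', funext fun x => ?_⟩
    rw [hσ', hσ]
    simp only [Function.comp_apply, Equiv.Perm.mul_apply, Equiv.Perm.coe_inv, Equiv.apply_symm_apply]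

end AnyField

/-- **Complex instance at `n = dim J`**: for a smooth projective complex curve with `dim J ≥ 1` and any base point, the relative-uniqueness hypothesis
of §1 holds at `n = dim J − 1 + 1` (★ (γ) `exists_opens_general_abelSum_of_isSmoothProjective` gives the stronger `hopen` shape).
[cite: Milne1986JacobianVarieties, §5 Thm. 5.1 (a)] [cite: Lange2023AbelianVarietiesComplex, §4.2.1 Lemma 4.2.1 (ii)] -/
theorem exists_opens_uniqueOn_abelSum_of_isSmoothProjective {C : SchemeOver ℂ} [IsIntegral C.left] [IsLocallyNoetherian C.left]
    (𝒥 : Jacobian C) (hC : IsSmoothProjective 1 C) (hdim : 1 ≤ 𝒥.J.dim) (P : AlgPoints C ℂ) :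
    ∃ U₁ : 𝒥.J.X.left.Opens, ((U₁ : Set 𝒥.J.X.left) ∩ 𝒥.brillNoetherLocus P (𝒥.J.dim - 1 + 1)).Nonempty ∧
      ∀ τ τ' : Fin (𝒥.J.dim - 1 + 1) → AlgPoints C ℂ, ((∏ j : Fin (𝒥.J.dim - 1 + 1), τ j ≫ 𝒥.abelJacobi P : 𝒥.J.Points ℂ)).pt ∈ U₁ →
        (∏ j : Fin (𝒥.J.dim - 1 + 1), τ' j ≫ 𝒥.abelJacobi P) = (∏ j : Fin (𝒥.J.dim - 1 + 1), τ j ≫ 𝒥.abelJacobi P) →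
          ∃ σ : Equiv.Perm (Fin (𝒥.J.dim - 1 + 1)), τ' = τ ∘ σ := by
  haveI : IsProper C.hom := IsSmoothProjective.isProper_holds hC
  obtain ⟨U₁, hU₁, h⟩ := 𝒥.exists_opens_general_abelSum_of_isSmoothProjective hC hdim P
  exact 𝒥.uniqueOn_of_hopen P ⟨U₁, hU₁, fun a ha => by
    obtain ⟨τ, -, hτ, hu⟩ := h a ha
    exact ⟨τ, hτ, hu⟩⟩

end Jacobian

end Literature.AlgebraicGeometry.Motives

end
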